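import Summits.KontsevichZagierPeriods.KontsevichZagierPeriods.Theses.UnfoldedStokes
import Summits.KontsevichZagierPeriods.KontsevichZagierPeriods.Theorems.UnfoldedStokesLegendreAllModuliStubSymmetrise
import Summits.KontsevichZagierPeriods.KontsevichZagierPeriods.Theorems.UnfoldedStokesLegendreAllModuliStubOctantTransferAux
import Summits.KontsevichZagierPeriods.KontsevichZagierPeriods.Theorems.UnfoldedStokesLegendreAllModuliStubDiscToStrip
import Summits.KontsevichZagierPeriods.KontsevichZagierPeriods.Theorems.UnfoldedStokesLegendreAllModuliStubStripNewtonLeibniz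
import Summits.KontsevichZagierPeriods.KontsevichZagierPeriods.Theorems.UnfoldedStokesLegendreAllModuliStubHalfLineTail
import Literature.NumberTheory.Transcendental.KZLogCalculusProofs
import Literature.NumberTheory.Transcendental.KZSemialgebraicComplex

/-!
# `LegendreAllModuli` (stmt-KontsevichZagierPeriods-3523, route UnfoldedStokes, crux rank 5) — line `Sketch`:
the octant transfer (stub M2) and the composition of the line

Legendre's relation `E K′ + E′ K − K K′ = π/2` at EVERY real algebraic modulus `k ∈ (0,1)`
INSIDE the four-move Kontsevich–Zagier calculus: `KZ.Equivalent r r'` for every representation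
`r = [(0,1)², e_k ⊗ κ_{k′} + e_{k′} ⊗ κ_k − κ_k ⊗ κ_{k′}]` and every `r' = [ℝ, 1/(2(1+x²))]`
(`κ_m(t) = ((1−t²)(1−mt²))^{-1/2}`, `e_m(t) = (1−mt²)^{1/2}(1−t²)^{-1/2}`, `m = k²`, `1 − m = k′²`).

## The line (five moves, ten move instances; no estimate anywhere)

`[□, f_k]` ~(M1, swap symmetrisation: `stub_symmetrise`)~ `[□, F_m]`,
`F_m = κ_m ⊗ e_{1−m} + e_m ⊗ κ_{1−m} − κ_m ⊗ κ_{1−m}`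
~(M2, ONE rule-(2) move along Jacobi's sphero-conal map
`Φ_m(x,y) = (x√(1−(1−m)y²), y√(1−mx²)) : (0,1)² ≅ Q`, `det DΦ_m = (1−mx²−(1−m)y²)/(√(1−mx²)√(1−(1−m)y²))`,
`1 − X² − Z² = (1−x²)(1−y²)`: the Legendre 2-form is the area form of the positive octant of `S²`;
chart facts `stub_spheroConalChart`, the move `stub_octantTransfer` below)~
`[Q = {X, Z > 0, X² + Z² < 1}, (1 − X² − Z²)^{-1/2}]`
~(M3, `stub_discToStrip`, rule 2 along `Θ(s,y) = (s√(1−y²)/√(1+s²), y)`)~ `[{0<s}×(0,1), 1/(1+s²)]`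
~(M4, `stub_stripNewtonLeibniz`, rule 3 along `y`)~ `[(0,∞), 1/(1+y²)]`
~(M5, `stub_halfLineTail`)~ `arctanRep = [ℝ, 1/(2(1+x²))]` ~(identity change of variables)~ `r'`.

## This file

* namespace `…LegendreAllModuliLine.OctantMove`: the Fréchet derivative of `Φ_m` and its
  determinant (`hasFDerivAt_spheroConal`, the `2 × 2` matrix in the standard basis); `Φ_m` is a
  `ℚ`-semialgebraic map on the square for real algebraic `m` (`isSemialgebraicMapOn_spheroConal`,
  the parameter entering through `isSemialgebraicFunOn_const_of_isAlgebraic`); the target data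
  `isSemialgebraic_quarterDisc`, `isSemialgebraicFunOn_octantDensity`;
* `stub_octantTransfer` (registered stub M2 of `Cruxes/LegendreAllModuli/Lines/Sketch.lean`): the
  target representation `p = [Q, (1−X²−Z²)^{-1/2}]` EXISTS — its integrability is TRANSPORTED from
  the given `q` by Mathlib's `integrableOn_image_iff_integrableOn_abs_det_fderiv_smul` and the
  Jacobian identity — and `[q] − [p] ∈ KZ.changeOfVariablesRel`;
* `LegendreAllModuli_of : LegendreAllModuli` — the composition over the five landed stub files
  (`…StubSymmetrise`, `…StubOctantTransferAux`, `…StubDiscToStrip`, `…StubStripNewtonLeibniz`,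
  `…StubHalfLineTail`).

No definitions are introduced. Sources: Kontsevich–Zagier 2001 §1.2 (the moves); C. G. J. Jacobi,
*Vorlesungen über Dynamik*, 26th lecture, and NIST DLMF §29.18 (sphero-conal coordinates);
the elementary real algebra is folklore.
-/

noncomputable section

open MeasureTheory Set
open Literature.NumberTheory.Transcendental
open Literature.NumberTheory.Transcendental.KZ
open Literature.ModelTheory.ExponentialFields (IsSemialgebraic)
open MvPolynomial (aeval X C)
open Summit.KontsevichZagierPeriods.Grothendieck.GpcLegendreLemniscaticNegative

namespace Summit.KontsevichZagierPeriods.UnfoldedStokes.LegendreAllModuliLine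

namespace OctantMove

open M2

/-! ## The Fréchet derivative of `Φ_m` and its determinant -/

/-- At a point `x` of the open square, `Φ_m` has a Fréchet derivative whose determinant is
`(1 − m x₀² − (1−m) x₁²)/(√(1 − m x₀²)·√(1 − (1−m) x₁²))`: the Jacobian matrix is
`[[d, −(1−m)x₀x₁/d], [−m x₀x₁/c, c]]` with `c = √(1 − m x₀²)`, `d = √(1 − (1−m) x₁²)`, and
`c²d² − m(1−m)x₀²x₁² = 1 − m x₀² − (1−m) x₁²`. [folklore] -/
theorem hasFDerivAt_spheroConal {m : ℝ} (hm : m ∈ Ioo (0:ℝ) 1) (x : Fin 2 → ℝ) (hx : x ∈ unitSq) :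
    ∃ L : (Fin 2 → ℝ) →L[ℝ] (Fin 2 → ℝ),
      HasFDerivAt (fun x : Fin 2 → ℝ =>
          (![x 0 * Real.sqrt (1 - (1 - m) * x 1 ^ 2), x 1 * Real.sqrt (1 - m * x 0 ^ 2)] : Fin 2 → ℝ)) L x ∧
        L.det = (1 - m * x 0 ^ 2 - (1 - m) * x 1 ^ 2) /
          (Real.sqrt (1 - m * x 0 ^ 2) * Real.sqrt (1 - (1 - m) * x 1 ^ 2)) := by
  have hC : 0 < 1 - m * x 0 ^ 2 := radC_pos hm hx
  have hD : 0 < 1 - (1 - m) * x 1 ^ 2 := radD_pos hm hx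
  have hsC : 0 < Real.sqrt (1 - m * x 0 ^ 2) := Real.sqrt_pos.2 hC
  have hsD : 0 < Real.sqrt (1 - (1 - m) * x 1 ^ 2) := Real.sqrt_pos.2 hD
  -- coordinate projections
  set P0 : (Fin 2 → ℝ) →L[ℝ] ℝ := ContinuousLinearMap.proj (R := ℝ) (φ := fun _ : Fin 2 => ℝ) 0
    with hP0
  set P1 : (Fin 2 → ℝ) →L[ℝ] ℝ := ContinuousLinearMap.proj (R := ℝ) (φ := fun _ : Fin 2 => ℝ) 1
    with hP1
  have hp0 : HasFDerivAt (fun v : Fin 2 → ℝ => v 0) P0 x := hasFDerivAt_apply 0 x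
  have hp1 : HasFDerivAt (fun v : Fin 2 → ℝ => v 1) P1 x := hasFDerivAt_apply 1 x
  -- the radicands `1 - m v0²`, `1 - (1 - m) v1²` and their square roots
  have hCd : HasFDerivAt (fun v : Fin 2 → ℝ => 1 - m * v 0 ^ 2)
      (-(m • (((2:ℕ) • x 0 ^ (2 - 1)) • P0))) x :=
    ((hp0.pow 2).const_mul m).const_sub 1
  have hDd : HasFDerivAt (fun v : Fin 2 → ℝ => 1 - (1 - m) * v 1 ^ 2)
      (-((1 - m) • (((2:ℕ) • x 1 ^ (2 - 1)) • P1))) x :=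
    ((hp1.pow 2).const_mul (1 - m)).const_sub 1
  set LC : (Fin 2 → ℝ) →L[ℝ] ℝ :=
    (1 / (2 * Real.sqrt (1 - m * x 0 ^ 2))) • -(m • (((2:ℕ) • x 0 ^ (2 - 1)) • P0)) with hLC
  have hsCd : HasFDerivAt (fun v : Fin 2 → ℝ => Real.sqrt (1 - m * v 0 ^ 2)) LC x := hCd.sqrt hC.ne'
  set LD : (Fin 2 → ℝ) →L[ℝ] ℝ :=
    (1 / (2 * Real.sqrt (1 - (1 - m) * x 1 ^ 2))) • -((1 - m) • (((2:ℕ) • x 1 ^ (2 - 1)) • P1))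
    with hLD
  have hsDd : HasFDerivAt (fun v : Fin 2 → ℝ => Real.sqrt (1 - (1 - m) * v 1 ^ 2)) LD x :=
    hDd.sqrt hD.ne'
  -- the two coordinates of `Φ_m`
  set L0 : (Fin 2 → ℝ) →L[ℝ] ℝ := x 0 • LD + Real.sqrt (1 - (1 - m) * x 1 ^ 2) • P0 with hL0
  have hΦ0 : HasFDerivAt (fun v : Fin 2 → ℝ => v 0 * Real.sqrt (1 - (1 - m) * v 1 ^ 2)) L0 x :=
    hp0.fun_mul hsDd
  set L1 : (Fin 2 → ℝ) →L[ℝ] ℝ := x 1 • LC + Real.sqrt (1 - m * x 0 ^ 2) • P1 with hL1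
  have hΦ1 : HasFDerivAt (fun v : Fin 2 → ℝ => v 1 * Real.sqrt (1 - m * v 0 ^ 2)) L1 x :=
    hp1.fun_mul hsCd
  -- assemble
  set F : Fin 2 → ((Fin 2 → ℝ) →L[ℝ] ℝ) := Fin.cons L0 (Fin.cons L1 finZeroElim) with hF
  have hF0 : F 0 = L0 := rfl
  have hF1 : F 1 = L1 := rfl
  refine ⟨ContinuousLinearMap.pi F, ?_, ?_⟩
  · apply hasFDerivAt_pi''
    intro i
    fin_cases i
    · simp only [Fin.zero_eta, ContinuousLinearMap.proj_pi, hF0, Matrix.cons_val_zero]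
      exact hΦ0
    · simp only [Fin.mk_one, ContinuousLinearMap.proj_pi, hF1, Matrix.cons_val_one,
        Matrix.cons_val_zero]
      exact hΦ1
  · -- the determinant, via the `2 × 2` matrix in the standard basis
    show LinearMap.det ((ContinuousLinearMap.pi F : (Fin 2 → ℝ) →L[ℝ] (Fin 2 → ℝ)) :
        (Fin 2 → ℝ) →ₗ[ℝ] (Fin 2 → ℝ)) = _
    rw [← LinearMap.det_toMatrix', Matrix.det_fin_two]
    simp only [LinearMap.toMatrix'_apply, ContinuousLinearMap.coe_coe, ContinuousLinearMap.pi_apply,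
      hF0, hF1, hL0, hL1, hLC, hLD, hP0, hP1]
    have hC2 : Real.sqrt (1 - m * x 0 ^ 2) ^ 2 = 1 - m * x 0 ^ 2 := Real.sq_sqrt hC.le
    have hD2 : Real.sqrt (1 - (1 - m) * x 1 ^ 2) ^ 2 = 1 - (1 - m) * x 1 ^ 2 := Real.sq_sqrt hD.le
    have hsC' : Real.sqrt (1 - m * x 0 ^ 2) ≠ 0 := hsC.ne'
    have hsD' : Real.sqrt (1 - (1 - m) * x 1 ^ 2) ≠ 0 := hsD.ne'
    simp
    field_simp
    rw [hC2, hD2]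
    ring

/-! ## Semialgebraicity -/

/-- `x ↦ 1 − a·x_i²` is a `ℚ`-semialgebraic function on a `ℚ`-semialgebraic set for real
algebraic `a`. [folklore] -/
theorem isSemialgebraicFunOn_one_sub_const_mul_sq {s : Set (Fin 2 → ℝ)} (hs : IsSemialgebraic ℚ s)
    {a : ℝ} (ha : IsAlgebraic ℚ a) (i : Fin 2) :
    IsSemialgebraicFunOn ℚ s (fun x => 1 - a * x i ^ 2) := by
  have hc := isSemialgebraicFunOn_const_of_isAlgebraic hs ha
  have hsq := isSemialgebraicFunOn_aeval hs (X i ^ 2 : MvPolynomial (Fin 2) ℚ)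
  have h1 := isSemialgebraicFunOn_ratCast hs 1
  have h := IsSemialgebraicFunOn.sub_holds h1 (IsSemialgebraicFunOn.mul_holds hc hsq)
  refine h.congr fun x _ => ?_
  simp

/-- `Φ_m` is a `ℚ`-semialgebraic map on the open square for real algebraic `m`: its coordinates
are products of coordinates with square roots of `ℚ(m)`-polynomials. [folklore] -/
theorem isSemialgebraicMapOn_spheroConal {m : ℝ} (hm : IsAlgebraic ℚ m)
    (hU : IsSemialgebraic ℚ unitSq) :
    IsSemialgebraicMapOn ℚ unitSq (fun x : Fin 2 → ℝ =>
      (![x 0 * Real.sqrt (1 - (1 - m) * x 1 ^ 2), x 1 * Real.sqrt (1 - m * x 0 ^ 2)] : Fin 2 → ℝ)) := by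
  have hm' : IsAlgebraic ℚ (1 - m) := isAlgebraic_one.sub hm
  have h0 : IsSemialgebraicFunOn ℚ unitSq (fun x : Fin 2 → ℝ => x 0) :=
    isSemialgebraicFunOn_apply hU 0
  have h1 : IsSemialgebraicFunOn ℚ unitSq (fun x : Fin 2 → ℝ => x 1) :=
    isSemialgebraicFunOn_apply hU 1
  have hC := IsSemialgebraicFunOn.sqrt_holds (isSemialgebraicFunOn_one_sub_const_mul_sq hU hm 0)
  have hD := IsSemialgebraicFunOn.sqrt_holds (isSemialgebraicFunOn_one_sub_const_mul_sq hU hm' 1)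
  refine IsSemialgebraicMapOn.of_forall hU fun j => ?_
  fin_cases j
  · simp only [Fin.zero_eta, Matrix.cons_val_zero]
    exact (IsSemialgebraicFunOn.mul_holds h0 hD).congr fun x _ => by simp
  · simp only [Fin.mk_one, Matrix.cons_val_one, Matrix.cons_val_zero]
    exact (IsSemialgebraicFunOn.mul_holds h1 hC).congr fun x _ => by simp

/-- The open quarter disc `Q = {0 < X, 0 < Z, X² + Z² < 1}` is `ℚ`-semialgebraic. [folklore] -/
theorem isSemialgebraic_quarterDisc :
    IsSemialgebraic ℚ {w : Fin 2 → ℝ | 0 < w 0 ∧ 0 < w 1 ∧ w 0 ^ 2 + w 1 ^ 2 < 1} := by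
  have h0 : IsSemialgebraic ℚ {z : Fin 2 → ℝ | 0 < z 0} := by
    simpa using Literature.ModelTheory.ExponentialFields.isSemialgebraic_setOf_eval_lt (k := ℚ)
      (R := ℝ) (0 : MvPolynomial (Fin 2) ℚ) (X 0)
  have h1 : IsSemialgebraic ℚ {z : Fin 2 → ℝ | 0 < z 1} := by
    simpa using Literature.ModelTheory.ExponentialFields.isSemialgebraic_setOf_eval_lt (k := ℚ)
      (R := ℝ) (0 : MvPolynomial (Fin 2) ℚ) (X 1)
  have h2 : IsSemialgebraic ℚ {z : Fin 2 → ℝ | z 0 ^ 2 + z 1 ^ 2 < 1} := by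
    have h := Literature.ModelTheory.ExponentialFields.isSemialgebraic_setOf_eval_lt (k := ℚ)
      (R := ℝ) (X 0 ^ 2 + X 1 ^ 2 : MvPolynomial (Fin 2) ℚ) 1
    simp only [map_add, map_pow, MvPolynomial.aeval_X, map_one] at h
    exact h
  convert h0.inter (h1.inter h2) using 1
  ext z
  simp

/-- The octant-area density `(1 − X² − Z²)^{-1/2}` is a `ℚ`-semialgebraic function on `Q`.
[folklore] -/
theorem isSemialgebraicFunOn_octantDensity :
    IsSemialgebraicFunOn ℚ {w : Fin 2 → ℝ | 0 < w 0 ∧ 0 < w 1 ∧ w 0 ^ 2 + w 1 ^ 2 < 1}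
      (fun w : Fin 2 → ℝ => 1 / Real.sqrt (1 - w 0 ^ 2 - w 1 ^ 2)) := by
  have hQ := isSemialgebraic_quarterDisc
  have hr := IsSemialgebraicFunOn.sqrt_holds
    (isSemialgebraicFunOn_aeval hQ (1 - X 0 ^ 2 - X 1 ^ 2 : MvPolynomial (Fin 2) ℚ))
  have h1 := isSemialgebraicFunOn_ratCast hQ 1
  refine ((h1.div hr) fun w hw => ?_).congr fun w _ => ?_
  · simp only [map_sub, map_one, map_pow, MvPolynomial.aeval_X]
    have : 0 < 1 - w 0 ^ 2 - w 1 ^ 2 := by linarith [hw.2.2]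
    exact (Real.sqrt_pos.2 this).ne'
  · simp

end OctantMove

open M2 OctantMove in
/-- **M2, octant transfer** (Jacobi's sphero-conal coordinates): for real algebraic `m ∈ (0,1)`,
ONE rule-(2) move along `Φ_m(x,y) = (x√(1−(1−m)y²), y√(1−mx²))`, a bijection of `(0,1)²` onto the
open quarter disc `Q` with `det DΦ_m = (1 − mx² − (1−m)y²)/(√(1−mx²)√(1−(1−m)y²)) > 0` and
`1 − X² − Z² = (1−x²)(1−y²)`, takes `[(0,1)², F_m]` to the octant-area representation
`[Q, (1 − X² − Z²)^{-1/2}]` (its integrability transported by the Jacobian formula).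
Given the chart facts M2a. [cite: KontsevichZagier2001, §1.2 rule (2)] -/
theorem stub_octantTransfer :
    (∀ m : ℝ, m ∈ Ioo (0:ℝ) 1 →
      InjOn (fun x : Fin 2 → ℝ => (![x 0 * Real.sqrt (1 - (1 - m) * x 1 ^ 2), x 1 * Real.sqrt (1 - m * x 0 ^ 2)] : Fin 2 → ℝ)) unitSq ∧
        (fun x : Fin 2 → ℝ => (![x 0 * Real.sqrt (1 - (1 - m) * x 1 ^ 2), x 1 * Real.sqrt (1 - m * x 0 ^ 2)] : Fin 2 → ℝ)) '' unitSq =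
          {w : Fin 2 → ℝ | 0 < w 0 ∧ 0 < w 1 ∧ w 0 ^ 2 + w 1 ^ 2 < 1} ∧
        ∀ x ∈ unitSq,
          1 / Real.sqrt ((1 - x 0 ^ 2) * (1 - m * x 0 ^ 2)) * (Real.sqrt (1 - (1 - m) * x 1 ^ 2) / Real.sqrt (1 - x 1 ^ 2)) +
              Real.sqrt (1 - m * x 0 ^ 2) / Real.sqrt (1 - x 0 ^ 2) * (1 / Real.sqrt ((1 - x 1 ^ 2) * (1 - (1 - m) * x 1 ^ 2))) -
              1 / Real.sqrt ((1 - x 0 ^ 2) * (1 - m * x 0 ^ 2)) * (1 / Real.sqrt ((1 - x 1 ^ 2) * (1 - (1 - m) * x 1 ^ 2))) =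
            1 / Real.sqrt (1 - (x 0 * Real.sqrt (1 - (1 - m) * x 1 ^ 2)) ^ 2 - (x 1 * Real.sqrt (1 - m * x 0 ^ 2)) ^ 2) *
              |(1 - m * x 0 ^ 2 - (1 - m) * x 1 ^ 2) / (Real.sqrt (1 - m * x 0 ^ 2) * Real.sqrt (1 - (1 - m) * x 1 ^ 2))|) →
    ∀ m : ℝ, IsAlgebraic ℚ m → m ∈ Ioo (0:ℝ) 1 →
      ∀ q : IntegralRep 2, q.domain = unitSq →
        EqOn q.integrand (fun x => 1 / Real.sqrt ((1 - x 0 ^ 2) * (1 - m * x 0 ^ 2)) *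
              (Real.sqrt (1 - (1 - m) * x 1 ^ 2) / Real.sqrt (1 - x 1 ^ 2)) +
            Real.sqrt (1 - m * x 0 ^ 2) / Real.sqrt (1 - x 0 ^ 2) *
              (1 / Real.sqrt ((1 - x 1 ^ 2) * (1 - (1 - m) * x 1 ^ 2))) -
            1 / Real.sqrt ((1 - x 0 ^ 2) * (1 - m * x 0 ^ 2)) *
              (1 / Real.sqrt ((1 - x 1 ^ 2) * (1 - (1 - m) * x 1 ^ 2)))) unitSq →
        ∃ p : IntegralRep 2, p.domain = {w : Fin 2 → ℝ | 0 < w 0 ∧ 0 < w 1 ∧ w 0 ^ 2 + w 1 ^ 2 < 1} ∧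
          EqOn p.integrand (fun w => 1 / Real.sqrt (1 - w 0 ^ 2 - w 1 ^ 2))
            {w : Fin 2 → ℝ | 0 < w 0 ∧ 0 < w 1 ∧ w 0 ^ 2 + w 1 ^ 2 < 1} ∧
          Equivalent q p := by
  classical
  intro hchart m hm hm01 q hqd hqi
  obtain ⟨hinj, himg, hjac⟩ := hchart m hm01
  -- the data of the square
  have hU : IsSemialgebraic ℚ unitSq := hqd ▸ q.isSemialgebraic_domain
  have hUm : MeasurableSet unitSq := hqd ▸ IntegralRep.measurableSet_domain_holds q
  -- the derivative of `Φ_m` on the square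
  choose L hL using (hasFDerivAt_spheroConal (m := m) hm01)
  set Φ' : (Fin 2 → ℝ) → (Fin 2 → ℝ) →L[ℝ] (Fin 2 → ℝ) :=
    fun x => if h : x ∈ unitSq then L x h else 0 with hΦ'
  have hderiv : ∀ x ∈ unitSq, HasFDerivWithinAt (fun x : Fin 2 → ℝ =>
      (![x 0 * Real.sqrt (1 - (1 - m) * x 1 ^ 2), x 1 * Real.sqrt (1 - m * x 0 ^ 2)] : Fin 2 → ℝ))
      (Φ' x) unitSq x := by
    intro x hx
    simp only [hΦ', dif_pos hx]
    exact (hL x hx).1.hasFDerivWithinAt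
  have hdet : ∀ x ∈ unitSq, (Φ' x).det = (1 - m * x 0 ^ 2 - (1 - m) * x 1 ^ 2) /
      (Real.sqrt (1 - m * x 0 ^ 2) * Real.sqrt (1 - (1 - m) * x 1 ^ 2)) := by
    intro x hx
    simp only [hΦ', dif_pos hx]
    exact (hL x hx).2
  -- the pulled-back density is the integrand of `q` on the square
  have hpull : ∀ x ∈ unitSq,
      |(Φ' x).det| • (fun w : Fin 2 → ℝ => 1 / Real.sqrt (1 - w 0 ^ 2 - w 1 ^ 2))
        ((![x 0 * Real.sqrt (1 - (1 - m) * x 1 ^ 2), x 1 * Real.sqrt (1 - m * x 0 ^ 2)] : Fin 2 → ℝ)) =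
        q.integrand x := by
    intro x hx
    rw [hqi hx]
    dsimp only
    rw [hjac x hx, hdet x hx, smul_eq_mul, mul_comm]
    simp only [Matrix.cons_val_zero, Matrix.cons_val_one, Matrix.cons_val_fin_one]
  -- integrability of the target density on `Q`, transported by the Jacobian formula
  have hint : IntegrableOn (fun w : Fin 2 → ℝ => 1 / Real.sqrt (1 - w 0 ^ 2 - w 1 ^ 2))
      {w : Fin 2 → ℝ | 0 < w 0 ∧ 0 < w 1 ∧ w 0 ^ 2 + w 1 ^ 2 < 1} := by
    rw [← himg, integrableOn_image_iff_integrableOn_abs_det_fderiv_smul volume hUm hderiv hinj]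
    have hq : IntegrableOn q.integrand unitSq := hqd ▸ q.integrableOn
    exact hq.congr_fun (fun x hx => (hpull x hx).symm) hUm
  -- the target representation
  set p : IntegralRep 2 := ⟨{w : Fin 2 → ℝ | 0 < w 0 ∧ 0 < w 1 ∧ w 0 ^ 2 + w 1 ^ 2 < 1},
    fun w : Fin 2 → ℝ => 1 / Real.sqrt (1 - w 0 ^ 2 - w 1 ^ 2), isSemialgebraic_quarterDisc,
    isSemialgebraicFunOn_octantDensity, hint⟩ with hp
  refine ⟨p, rfl, fun w _ => rfl, ?_⟩
  -- ONE change of variables along `Φ_m`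
  show of q - of p ∈ relations
  apply changeOfVariablesRel_subset_relations
  refine ⟨2, q, p, fun x : Fin 2 → ℝ =>
      (![x 0 * Real.sqrt (1 - (1 - m) * x 1 ^ 2), x 1 * Real.sqrt (1 - m * x 0 ^ 2)] : Fin 2 → ℝ),
    Φ', ?_, ?_, ?_, ?_, ?_, rfl⟩
  · rw [hqd]
    exact isSemialgebraicMapOn_spheroConal hm hU
  · rw [hqd]
    exact hderiv
  · rw [hqd]
    exact hinj
  · rw [hqd, himg]
  · intro x hx
    rw [hqd] at hx
    have h := hpull x hx
    rw [smul_eq_mul, mul_comm] at h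
    exact h.symm

open Summit.KontsevichZagierPeriods.KontsevichZagierPeriods.Theses.UnfoldedStokes (LegendreAllModuli) in
/-- **Composition**: the five moves M1–M5 chain `r ~ q ~ p ~ s ~ a ~ arctanRep`, and the identity
change of variables `equivalent_of_eqOn` absorbs the crux's `∀ r'` shape (`r'.domain = univ`,
integrand `1/(2(1+x²))` on it); `m = k²` is algebraic and lies in `(0,1)`. [folklore] -/
theorem LegendreAllModuli_of : LegendreAllModuli := by
  intro k hk hk0 hk1 r r' hrd hri hr'd hr'i
  have hm : IsAlgebraic ℚ (k ^ 2) := hk.pow 2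
  have hm01 : k ^ 2 ∈ Ioo (0:ℝ) 1 := ⟨by positivity, by nlinarith⟩
  have hrd' : r.domain = unitSq := hrd
  have hri' := hri
  rw [hrd'] at hri'
  obtain ⟨q, hqd, hqi, hq⟩ := stub_symmetrise k hk hk0 hk1 r hrd' hri'
  obtain ⟨p, hpd, hpi, hp⟩ := stub_octantTransfer stub_spheroConalChart (k ^ 2) hm hm01 q hqd hqi
  obtain ⟨s, hsd, hsi, hs⟩ := stub_discToStrip p hpd hpi
  obtain ⟨a, had, hai, ha⟩ := stub_stripNewtonLeibniz s hsd hsi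
  have h5 : Equivalent a arctanRep := stub_halfLineTail a had hai
  have h6 : Equivalent arctanRep r' := by
    refine equivalent_of_eqOn arctanRep r' (show r'.domain = arctanRep.domain from hr'd) fun x _ => ?_
    have hx : x ∈ r'.domain := by rw [hr'd]; trivial
    show arctanRep.integrand x = r'.integrand x
    exact (hr'i hx).symm
  exact hq.trans (hp.trans (hs.trans (ha.trans (h5.trans h6))))

end Summit.KontsevichZagierPeriods.UnfoldedStokes.LegendreAllModuliLine
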